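import Summits.RiemannHypothesis.RiemannHypothesis.Theses.WeilWindowFlow
import Summits.RiemannHypothesis.RiemannHypothesis.Theorems.WeilWindowFlowWindowLipschitz

/-! F3 WITNESS for the rung family `HolderLeakage θ` (Sketch.lean, copied verbatim): the floor parameter is
`θ = 0`, and `HolderLeakage 0` IS the seed `WindowLipschitz_proof` (item stmt-RiemannHypothesis-1039). -/

noncomputable section
namespace Summit.RiemannHypothesis.RiemannHypothesis.Theses.FwdRung02
open Literature.NumberTheory.LFunctions

def HolderLeakage (θ : ℝ) : Prop :=
  ∀ b₀ A : ℝ, 0 < b₀ → b₀ ≤ A → ∃ L : ℝ, ∀ b a : ℝ, b₀ ≤ b → b ≤ a → a ≤ A →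
    weilGroundEnergy b - weilGroundEnergy a ≤
      L * (a - b) * max |weilGroundEnergy b| |weilGroundEnergy a| ^ θ

/-- The rung specialises to the proved floor (no sorry). -/
example : HolderLeakage 0 := by
  simpa [HolderLeakage, Summit.RiemannHypothesis.RiemannHypothesis.Theses.WeilWindowFlow.WindowLipschitz] using
    Summit.RiemannHypothesis.RiemannHypothesis.Theorems.WeilWindowFlowWindowLipschitz.WindowLipschitz_proof

end Summit.RiemannHypothesis.RiemannHypothesis.Theses.FwdRung02
end
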